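import Summits.AtomisticToContinuum.Crystallization.Theorems.MinimisingLawsCohesive.Negative.OnePointMixtures
import Summits.AtomisticToContinuum.Crystallization.Theorems.PalmUnimodularRigidityUnimodularEnergyLowerBound
import Literature.Probability.Process.LocallyMatches

/-!
# Negative knowledge for crux `MinimisingLawsHaveAtoms` (stmt-AtomisticToContinuum-15776), VII:
# restriction of point-stationary laws to invariant events; minimising laws do not charge the
# one-point configuration

Standing crux disprover `cdisprove-stmt-AtomisticToContinuum-15776`,
`--supports stmt-AtomisticToContinuum-15776`; second piece of the threshold-sharpness programme and
a structural fact about the frame.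

* `IsPointStationaryLaw.restrict_of_invariant` — if `T` is a measurable set of configurations that
  is RE-ROOTING INVARIANT `P`-a.s. (`θ_y μ ∈ T ↔ μ ∈ T` for `μ`-a.e. `y`), the restriction `P|_T`
  of a point-stationary law is point-stationary (Mecke identity tested on `1_T(μ) g(μ, y)`).  So the
  cone of point-stationary laws splits along invariant events, and by the landed Palm-side
  stability (9229) EVERY invariant piece of a minimising law is minimising.
* `ae_map_sub_eq_dirac_iff` — the one-point event `{δ_0}` is re-rooting invariant on hard-core
  configurations; `measure_setOf_eq_dirac_zero_eq_zero` — **a minimising law gives it mass `0`**: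
  otherwise the one-point piece has energy `0` and the rest at least `(1 − p) e*`, total `> e*`
  (`e* < 0`).  Hence a.s. the configuration of a minimising law has a second point.
Moral: a diffuse counterexample lives on infinite configurations only in the weak sense certified
here (no isolated root); the same splitting with `T_N = {μ(univ) = N}` and the uniform-rooting
identity would exclude every finite cluster (`E(N)/N > e*`, landed) — left to a later part.
All `[folklore]`.
-/

noncomputable section

namespace Summit.AtomisticToContinuum.Crystallization.Theorems.MinimisingLawsHaveAtoms.Negative.OnePointNull

open MeasureTheory Set Function
open scoped ENNReal
open Literature.MathematicalPhysics.StatisticalMechanics Literature.Probability.Process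
open Summit.AtomisticToContinuum.Crystallization.Theorems.ChargedEnergyGapNegative (eStar eStar_le)
open Summit.AtomisticToContinuum.Crystallization.Theorems.PricedLinkCensusLocalToGlobalPhaseGap
  (eStar_le_neg)
open Summit.AtomisticToContinuum.Crystallization.Theorems.MinimisingLawsCohesive.Negative.OnePointMixtures
  (integrable_of_integral_le_eStar)
open Summit.AtomisticToContinuum.Crystallization.Theorems.UnimodularEnergy
  (countable_of_separated)

/-! ## §1 Restriction of a point-stationary law to an invariant event -/

/-- **Point-stationary laws restrict to re-rooting invariant events.** If `T` is measurable and
`P`-a.s. `θ_y μ ∈ T ↔ μ ∈ T` for `μ`-a.e. `y`, then `P|_T` satisfies the Mecke identity (test the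
identity of `P` on `1_T(μ) · g(μ, y)`). [folklore] -/
theorem _root_.Literature.Probability.Process.IsPointStationaryLaw.restrict_of_invariant
    {P : Measure (Measure (EuclideanSpace ℝ (Fin 3)))} (hP : IsPointStationaryLaw P)
    {T : Set (Measure (EuclideanSpace ℝ (Fin 3)))} (hT : MeasurableSet T)
    (hinv : ∀ᵐ μ ∂P, ∀ᵐ y ∂μ, (μ.map (fun z => z - y) ∈ T ↔ μ ∈ T)) :
    IsPointStationaryLaw (P.restrict T) := by
  intro g hg
  set g₁ : Measure (EuclideanSpace ℝ (Fin 3)) → EuclideanSpace ℝ (Fin 3) → ℝ≥0∞ :=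
    fun μ y => T.indicator (fun _ => (1 : ℝ≥0∞)) μ * g μ y with hg₁
  have hg₁m : Measurable (uncurry g₁) :=
    ((measurable_const.indicator hT).comp measurable_fst).mul hg
  have key := hP g₁ hg₁m
  have hL : ∫⁻ μ in T, ∫⁻ y, g μ y ∂μ ∂P = ∫⁻ μ, ∫⁻ y, g₁ μ y ∂μ ∂P := by
    rw [← lintegral_indicator hT]
    refine lintegral_congr fun μ => ?_
    by_cases hμ : μ ∈ T
    · simp [hg₁, indicator_of_mem hμ]
    · simp [hg₁, indicator_of_notMem hμ]
  have hR : ∫⁻ μ in T, ∫⁻ y, g (μ.map fun z => z - y) (-y) ∂μ ∂P =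
      ∫⁻ μ, ∫⁻ y, g₁ (μ.map fun z => z - y) (-y) ∂μ ∂P := by
    rw [← lintegral_indicator hT]
    refine lintegral_congr_ae (hinv.mono fun μ hμ => ?_)
    by_cases hμT : μ ∈ T
    · rw [indicator_of_mem hμT]
      refine lintegral_congr_ae (hμ.mono fun y hy => ?_)
      simp [hg₁, indicator_of_mem (hy.2 hμT)]
    · rw [indicator_of_notMem hμT]
      symm
      refine (lintegral_congr_ae (hμ.mono fun y hy => ?_)).trans lintegral_zero
      have : μ.map (fun z => z - y) ∉ T := fun h => hμT (hy.1 h)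
      simp [hg₁, indicator_of_notMem this]
  rw [hL, hR]
  exact key

/-- The complement of an a.s. invariant event is a.s. invariant. [folklore] -/
theorem ae_invariant_compl {P : Measure (Measure (EuclideanSpace ℝ (Fin 3)))}
    {T : Set (Measure (EuclideanSpace ℝ (Fin 3)))}
    (hinv : ∀ᵐ μ ∂P, ∀ᵐ y ∂μ, (μ.map (fun z => z - y) ∈ T ↔ μ ∈ T)) :
    ∀ᵐ μ ∂P, ∀ᵐ y ∂μ, (μ.map (fun z => z - y) ∈ Tᶜ ↔ μ ∈ Tᶜ) :=
  hinv.mono fun _ hμ => hμ.mono fun _ hy => not_congr hy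

/-! ## §2 The one-point event is re-rooting invariant on hard-core configurations -/

/-- `count|S = δ_0` iff `S = {0}` (for `0 ∈ S`). [folklore] -/
theorem count_restrict_eq_dirac_zero_iff {S : Set (EuclideanSpace ℝ (Fin 3))} :
    (Measure.count : Measure (EuclideanSpace ℝ (Fin 3))).restrict S = Measure.dirac 0 ↔ S = {0} := by
  constructor
  · intro h
    have := congrArg atoms h
    rwa [atoms_count_restrict, atoms_dirac] at this
  · rintro rfl
    rw [Measure.restrict_singleton, Measure.count_singleton, one_smul]

/-- **The one-point event is invariant under re-rooting a hard-core configuration at its points**: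
for `μ` rooted `δ`-hard-core (`δ > 0`) and `μ`-a.e. `y`, `θ_y μ = δ_0 ↔ μ = δ_0`. [folklore] -/
theorem ae_map_sub_eq_dirac_iff {δ : ℝ} (hδ : 0 < δ) {μ : Measure (EuclideanSpace ℝ (Fin 3))}
    (hμ : IsRootedHardCore δ μ) :
    ∀ᵐ y ∂μ, (μ.map (fun z => z - y) ∈ {ν : Measure (EuclideanSpace ℝ (Fin 3)) | ν = Measure.dirac 0} ↔
      μ ∈ {ν : Measure (EuclideanSpace ℝ (Fin 3)) | ν = Measure.dirac 0}) := by
  obtain ⟨S, h0, hsep, rfl⟩ := hμ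
  have hSm : MeasurableSet S := (countable_of_separated hδ hsep).measurableSet
  filter_upwards [ae_restrict_mem hSm] with y hy
  simp only [map_sub_count_restrict, count_restrict_eq_dirac_zero_iff]
  constructor
  · intro h
    have hy0 : y - y ∈ (fun z => z - y) '' S := ⟨y, hy, rfl⟩
    have h00 : (0 : EuclideanSpace ℝ (Fin 3)) - y ∈ (fun z => z - y) '' S := ⟨0, h0, rfl⟩
    rw [h, mem_singleton_iff] at hy0 h00
    rw [sub_self] at hy0
    have hy' : y = 0 := by
      have := h00; rw [zero_sub, neg_eq_zero] at this; exact this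
    subst hy'
    simpa using h
  · rintro rfl
    rw [mem_singleton_iff] at hy
    subst hy
    simp

/-! ## §3 Minimising laws do not charge the one-point configuration -/

/-- On the one-point event the root energy vanishes. [folklore] -/
theorem rootEnergy_eq_zero_of_mem {μ : Measure (EuclideanSpace ℝ (Fin 3))}
    (hμ : μ ∈ {ν : Measure (EuclideanSpace ℝ (Fin 3)) | ν = Measure.dirac 0}) :
    rootEnergy lennardJones μ = 0 := by
  rw [mem_setOf_eq] at hμ
  rw [hμ, rootEnergy_dirac, norm_zero, lennardJones_zero, zero_div]

/-- **A minimising law gives mass `0` to the one-point configuration** (frame of the crux: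
probability, a.s. `δ`-hard-core with `δ > 0`, point-stationary, `E_P[h] ≤ e*`). Otherwise split
`P = P|_{δ_0} + P|_{rest}`: both pieces are point-stationary (§1–§2), the first has energy `0`, the
second at least `(1 − p) e*` by Palm-side stability (9229), so `E_P[h] ≥ (1 − p) e* > e*`.
[folklore] -/
theorem measure_setOf_eq_dirac_zero_eq_zero {δ : ℝ} (hδ : 0 < δ)
    {P : Measure (Measure (EuclideanSpace ℝ (Fin 3)))} [IsProbabilityMeasure P]
    (hhc : ∀ᵐ μ ∂P, IsRootedHardCore δ μ) (hst : IsPointStationaryLaw P)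
    (hE : (∫ μ, rootEnergy lennardJones μ ∂P) ≤ eStar) :
    P {ν : Measure (EuclideanSpace ℝ (Fin 3)) | ν = Measure.dirac 0} = 0 := by
  set T : Set (Measure (EuclideanSpace ℝ (Fin 3))) := {ν | ν = Measure.dirac 0} with hTdef
  have hT : MeasurableSet T := measurableSet_setOf_eq_dirac_zero (measurableSet_singleton 0)
  have hinv : ∀ᵐ μ ∂P, ∀ᵐ y ∂μ, (μ.map (fun z => z - y) ∈ T ↔ μ ∈ T) :=
    hhc.mono fun μ hμ => ae_map_sub_eq_dirac_iff hδ hμ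
  by_contra hp
  have hes : eStar < 0 := by linarith [eStar_le_neg]
  have hint : Integrable (fun μ : Measure (EuclideanSpace ℝ (Fin 3)) => rootEnergy lennardJones μ) P :=
    integrable_of_integral_le_eStar hE
  -- split the energy along `T`
  have hsplit : (∫ μ, rootEnergy lennardJones μ ∂P) =
      (∫ μ in T, rootEnergy lennardJones μ ∂P) + ∫ μ in Tᶜ, rootEnergy lennardJones μ ∂P :=
    (integral_add_compl hT hint).symm
  have hT0 : (∫ μ in T, rootEnergy lennardJones μ ∂P) = 0 := by
    rw [setIntegral_congr_fun hT fun μ hμ => rootEnergy_eq_zero_of_mem hμ, integral_zero]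
  -- the mass of the complement
  have hpT : P T ≤ 1 := prob_le_one
  have hpc : P Tᶜ = 1 - P T := prob_compl_eq_one_sub hT
  by_cases hc0 : P Tᶜ = 0
  · -- everything sits on the one-point configuration: energy `0 > e*`
    have : (∫ μ in Tᶜ, rootEnergy lennardJones μ ∂P) = 0 := by
      rw [Measure.restrict_eq_zero.2 hc0, integral_zero_measure]
    rw [hsplit, hT0, this, add_zero] at hE
    linarith
  · -- normalise the rest: a point-stationary hard-core probability law, energy `≥ e*` (9229)
    set m : ℝ≥0∞ := P Tᶜ with hm
    have hmtop : m ≠ ∞ := measure_ne_top P _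
    set P' : Measure (Measure (EuclideanSpace ℝ (Fin 3))) := m⁻¹ • P.restrict Tᶜ with hP'
    haveI : IsProbabilityMeasure P' :=
      ⟨by rw [hP', Measure.smul_apply, Measure.restrict_apply_univ, smul_eq_mul,
        ENNReal.inv_mul_cancel hc0 hmtop]⟩
    have hhc' : ∀ᵐ μ ∂P', IsRootedHardCore δ μ :=
      Measure.ae_smul_measure (ae_restrict_of_ae hhc) _
    have hst' : IsPointStationaryLaw P' :=
      (hst.restrict_of_invariant hT.compl (ae_invariant_compl hinv)).smul _
    have h9229 := UnimodularEnergy.eStar_le_integral_rootEnergy hδ hhc' hst'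
    have hE' : (∫ μ, (∫ y, lennardJones ‖y‖ ∂μ) / 2 ∂P') =
        m⁻¹.toReal * ∫ μ in Tᶜ, rootEnergy lennardJones μ ∂P := by
      rw [hP', integral_smul_measure, smul_eq_mul]
      rfl
    rw [hE'] at h9229
    -- `m.toReal * e* ≤ ∫_{Tᶜ} h`
    have hmpos : 0 < m.toReal := ENNReal.toReal_pos hc0 hmtop
    have hm1 : m.toReal < 1 := by
      have hTpos : 0 < P T := pos_iff_ne_zero.2 hp
      have : m < 1 := by
        rw [hpc]
        exact ENNReal.sub_lt_self ENNReal.one_ne_top one_ne_zero hTpos.ne'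
      have := (ENNReal.toReal_lt_toReal hmtop ENNReal.one_ne_top).2 this
      rwa [ENNReal.toReal_one] at this
    have hrest : m.toReal * eStar ≤ ∫ μ in Tᶜ, rootEnergy lennardJones μ ∂P := by
      have := mul_le_mul_of_nonneg_left h9229 hmpos.le
      rwa [← mul_assoc, ENNReal.toReal_inv, mul_inv_cancel₀ hmpos.ne', one_mul] at this
    rw [hsplit, hT0, zero_add] at hE
    nlinarith

/-- **A.s. a minimising law's configuration has a second point** (the root is never isolated as the
whole configuration). [folklore] -/
theorem ae_ne_dirac_zero {δ : ℝ} (hδ : 0 < δ)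
    {P : Measure (Measure (EuclideanSpace ℝ (Fin 3)))} [IsProbabilityMeasure P]
    (hhc : ∀ᵐ μ ∂P, IsRootedHardCore δ μ) (hst : IsPointStationaryLaw P)
    (hE : (∫ μ, rootEnergy lennardJones μ ∂P) ≤ eStar) :
    ∀ᵐ μ ∂P, μ ≠ Measure.dirac 0 := by
  rw [ae_iff]
  simpa only [not_not] using measure_setOf_eq_dirac_zero_eq_zero hδ hhc hst hE

end Summit.AtomisticToContinuum.Crystallization.Theorems.MinimisingLawsHaveAtoms.Negative.OnePointNull

end
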